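import Mathlib

/-!
# Sampled supervised split: importance-sampling identities, Pearson-ratio perturbation,
# and sample budgets (DEQ-A53)

HONEST FRAMING: instance-level adjudication of specific advantage claims; no claim about
BQP vs BPP or the summit.

Context (cell pub-qadeq, claim A-53 = Kumar, Yalovetzky, Li, Minssen, Pistoia, "Des-q: a quantum
algorithm to provably speedup retraining of decision trees", Quantum 9, 1588 (2025) =
arXiv:2309.09976v6, Theorems 5.1–5.7 and 6.1; companion lower/upper bounds for sampled centroids:
Cornelissen, Doriguello, Luongo, Tang, arXiv:2308.09701v3, Def. 9, Alg. 1, Thm 11, Thm 21).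
DEQ-A53.md (unit pub-qadeq-deq-1) gives a classical sampling algorithm ("Algorithm S") that meets
Des-q's per-step output contract (Pearson feature weights to `±ε_w`, every supervised-k-means
centroid of every tree node to `±ε_c` per coordinate with exact assignment of the sampled points,
leaf labels to `±ε_lab`) at a cost independent of the number `N` of training examples.  The
probabilistic statements (Hoeffding, Chernoff, conditional uniformity) are NOT formalised here;
this file proves, sorry-free, the finite identities and the real arithmetic the analysis reduces to:

* `importance_mean`, `importance_second_moment`: length-square importance sampling with weights
  `p_i = r_i/F`, `F = Σ r_i`, and the cell-restricted estimator `Z_i = F e_i / r_i · 1_C(i)` is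
  unbiased for `Σ_{i∈C} e_i` and has second moment `≤ F · M · |C|` when `e_i² ≤ M r_i`
  (Prop. A53′: `r_i = y_i²`, `e_i = x_{ij} y_i` for the Pearson numerator; `r_i = ‖x_i‖²`,
  `e_i = x_{il}` for a centroid coordinate, as in arXiv:2308.09701 Alg. 1);
* `central_moment_perturb`: raw moments known to `±τ` give `c − a b` to `±3τ` (Lemma W(i));
* `ratio_perturb`: the square-root–free core of Lemma W(ii): if `|a'−a|, |b'−b|, |c'−c| ≤ 3τ`,
  `b, c ≥ v ≥ 6τ`, `a² ≤ bc`, `s = √(bc)`, `s' = √(b'c')`, then `|a'/s' − a/s| ≤ 12τ/v`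
  (apply with `a = cov(x_j, y)`, `b = Var x_j`, `c = Var y`: the Pearson weight moves by
  `≤ 12τ/v_min`);
* `hoeffding_union_budget`, `chernoff_occupancy_budget`, `cell_budget`: the three lines of
  arithmetic turning `n ≥ (2/ε²) log(2M/δ)` into `2M e^{−nε²/2} ≤ δ`, `μ ≥ 8 log(M/δ)` into
  `M e^{−μ/8} ≤ δ`, and `m ≥ q·n`, `p ≥ 1/q` into `m p ≥ n` (Theorem A53 (ii)–(iii)).

Everything is `[folklore]`-level finite algebra / real arithmetic; no named fact, no axiom.
-/

namespace Literature.Computability.QuantumAlgorithms.SampledSupervisedSplit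

open Finset BigOperators

section Importance

variable {ι : Type*} [DecidableEq ι]

/-- `[folklore]` length-square importance sampling is unbiased for cell-restricted sums:
with `F = Σ_{i∈s} r_i ≠ 0`, weights `p_i = r_i/F` and `Z_i = F e_i/r_i` on `C ⊆ s` (zero off `C`),
`Σ_{i∈s} p_i Z_i = Σ_{i∈C} e_i`, provided `r_i = 0 → e_i = 0`
(DEQ-A53 Prop. A53′; arXiv:2308.09701 Alg. 1). -/
theorem importance_mean (s C : Finset ι) (hC : C ⊆ s) (r e : ι → ℝ)
    (hre : ∀ i ∈ s, r i = 0 → e i = 0) (hF : (∑ l ∈ s, r l) ≠ 0) :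
    ∑ i ∈ s, (r i / ∑ l ∈ s, r l) * (if i ∈ C then (∑ l ∈ s, r l) * e i / r i else 0)
      = ∑ i ∈ C, e i := by
  set F := ∑ l ∈ s, r l with hFdef
  have h1 : ∑ i ∈ s, (r i / F) * (if i ∈ C then F * e i / r i else 0)
      = ∑ i ∈ s, (if i ∈ C then e i else 0) := by
    refine Finset.sum_congr rfl fun i hi => ?_
    split_ifs with hiC
    · by_cases hri : r i = 0
      · simp [hri, hre i hi hri]
      · field_simp
    · simp
  rw [h1, Finset.sum_ite_mem, Finset.inter_eq_right.mpr hC]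

/-- `[folklore]` second moment of the cell-restricted length-square estimator:
if `0 ≤ r_i`, `e_i² ≤ M r_i` on `s` and `F = Σ_{i∈s} r_i > 0`, then
`Σ_{i∈s} p_i Z_i² ≤ F · M · |C|` (so `Var ≤ ‖·‖²_F-type × |C|`, DEQ-A53 Prop. A53′). -/
theorem importance_second_moment (s C : Finset ι) (hC : C ⊆ s) (r e : ι → ℝ) (M : ℝ)
    (hM : 0 ≤ M) (hr : ∀ i ∈ s, 0 ≤ r i) (he : ∀ i ∈ s, e i ^ 2 ≤ M * r i)
    (hF : 0 < ∑ l ∈ s, r l) :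
    ∑ i ∈ s, (r i / ∑ l ∈ s, r l) * (if i ∈ C then (∑ l ∈ s, r l) * e i / r i else 0) ^ 2
      ≤ (∑ l ∈ s, r l) * M * C.card := by
  set F := ∑ l ∈ s, r l with hFdef
  have h1 : ∀ i ∈ s, (r i / F) * (if i ∈ C then F * e i / r i else 0) ^ 2
      ≤ if i ∈ C then F * M else 0 := by
    intro i hi
    split_ifs with hiC
    · by_cases hri : r i = 0
      · simp [hri]; positivity
      · have hri' : 0 < r i := lt_of_le_of_ne (hr i hi) (Ne.symm hri)
        have hq : e i ^ 2 / r i ≤ M := by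
          rw [div_le_iff₀ hri']; exact he i hi
        have hrew : (r i / F) * (F * e i / r i) ^ 2 = F * (e i ^ 2 / r i) := by
          field_simp
        rw [hrew]
        exact mul_le_mul_of_nonneg_left hq hF.le
    · simp
  calc ∑ i ∈ s, (r i / F) * (if i ∈ C then F * e i / r i else 0) ^ 2
      ≤ ∑ i ∈ s, (if i ∈ C then F * M else 0) := Finset.sum_le_sum h1
    _ = ∑ i ∈ C, F * M := by rw [Finset.sum_ite_mem, Finset.inter_eq_right.mpr hC]
    _ = F * M * C.card := by rw [Finset.sum_const, nsmul_eq_mul]; ring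

end Importance

/-- `[folklore]` raw moments to `±τ` give the central moment `c − a b` to `±3τ` when `|a'|, |b| ≤ 1`
(DEQ-A53 Lemma W(i): `a = E x_j`, `b = E y`, `c = E x_j y`, entries in `[−1,1]`). -/
theorem central_moment_perturb {a b c a' b' c' τ : ℝ} (h1 : |a' - a| ≤ τ) (h2 : |b' - b| ≤ τ)
    (h3 : |c' - c| ≤ τ) (ha : |a'| ≤ 1) (hb : |b| ≤ 1) :
    |(c' - a' * b') - (c - a * b)| ≤ 3 * τ := by
  have p1 : |a' * (b' - b)| ≤ τ := by
    rw [abs_mul]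
    calc |a'| * |b' - b| ≤ 1 * τ := mul_le_mul ha h2 (abs_nonneg _) zero_le_one
      _ = τ := one_mul τ
  have p2 : |b * (a' - a)| ≤ τ := by
    rw [abs_mul]
    calc |b| * |a' - a| ≤ 1 * τ := mul_le_mul hb h1 (abs_nonneg _) zero_le_one
      _ = τ := one_mul τ
  have e : (c' - a' * b') - (c - a * b) = (c' - c) - (a' * (b' - b) + b * (a' - a)) := by ring
  rw [e]
  obtain ⟨q1, q1'⟩ := abs_le.mp p1
  obtain ⟨q2, q2'⟩ := abs_le.mp p2
  obtain ⟨q3, q3'⟩ := abs_le.mp h3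
  exact abs_le.mpr ⟨by linarith, by linarith⟩

/-- `[folklore]` square-root–free core of the Pearson-weight perturbation (DEQ-A53 Lemma W(ii)):
central moments to `±3τ`, variances `b, c ≥ v ≥ 6τ`, Cauchy–Schwarz `a² ≤ bc`, and
`s, s' ≥ 0` with `s² = bc`, `s'² = b'c'` give `|a'/s' − a/s| ≤ 12τ/v`. -/
theorem ratio_perturb {a b c a' b' c' s s' v τ : ℝ} (hv : 0 < v) (hτ : 0 ≤ τ) (hτv : 6 * τ ≤ v)
    (hb : v ≤ b) (hc : v ≤ c) (habc : a ^ 2 ≤ b * c)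
    (h1 : |a' - a| ≤ 3 * τ) (h2 : |b' - b| ≤ 3 * τ) (h3 : |c' - c| ≤ 3 * τ)
    (hs : 0 ≤ s) (hs2 : s ^ 2 = b * c) (hs' : 0 ≤ s') (hs'2 : s' ^ 2 = b' * c') :
    |a' / s' - a / s| ≤ 12 * τ / v := by
  obtain ⟨h2l, h2u⟩ := abs_le.mp h2
  obtain ⟨h3l, h3u⟩ := abs_le.mp h3
  have hb0 : 0 < b := lt_of_lt_of_le hv hb
  have hc0 : 0 < c := lt_of_lt_of_le hv hc
  have hb' : v / 2 ≤ b' := by linarith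
  have hc' : v / 2 ≤ c' := by linarith
  have hb'0 : 0 < b' := lt_of_lt_of_le (by positivity) hb'
  have hc'0 : 0 < c' := lt_of_lt_of_le (by positivity) hc'
  have hss : s * s = b * c := by rw [← hs2]; ring
  have hss' : s' * s' = b' * c' := by rw [← hs'2]; ring
  -- `v ≤ s` and `v/2 ≤ s'`
  have hvs : v ≤ s := by
    by_contra h
    have h' : s * s < v * v := mul_self_lt_mul_self hs (not_le.mp h)
    have : v * v ≤ b * c := mul_le_mul hb hc hv.le hb0.le
    linarith
  have hvs' : v / 2 ≤ s' := by
    by_contra h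
    have h' : s' * s' < (v / 2) * (v / 2) := mul_self_lt_mul_self hs' (not_le.mp h)
    have : (v / 2) * (v / 2) ≤ b' * c' := mul_le_mul hb' hc' (by positivity) hb'0.le
    linarith
  have hs0 : 0 < s := lt_of_lt_of_le hv hvs
  have hs'0 : 0 < s' := lt_of_lt_of_le (by positivity) hvs'
  have hsne : s ≠ 0 := ne_of_gt hs0
  have hs'ne : s' ≠ 0 := ne_of_gt hs'0
  -- `|a| ≤ s`
  have has : |a| ≤ s := by
    have h0 : a ^ 2 ≤ s ^ 2 := by rw [hs2]; exact habc
    have := sq_le_sq.mp h0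
    rwa [abs_of_nonneg hs] at this
  have e1 : (v * s) ^ 2 = (v * b) * (v * c) := by
    rw [show (v * s) ^ 2 = v * v * (s * s) by ring, hss]; ring
  -- (A) `v s ≤ (v + 6τ) s'`
  have hA : v * s ≤ (v + 6 * τ) * s' := by
    have hA1 : v * b ≤ (v + 6 * τ) * (b - 3 * τ) := by
      nlinarith [mul_nonneg hτ (by linarith : (0:ℝ) ≤ 2 * b - v - 6 * τ)]
    have hA2 : v * c ≤ (v + 6 * τ) * (c - 3 * τ) := by
      nlinarith [mul_nonneg hτ (by linarith : (0:ℝ) ≤ 2 * c - v - 6 * τ)]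
    have hb3 : 0 ≤ b - 3 * τ := by linarith
    have hc3 : 0 ≤ c - 3 * τ := by linarith
    have hv6 : 0 ≤ v + 6 * τ := by positivity
    have hsq : (v * s) ^ 2 ≤ ((v + 6 * τ) * s') ^ 2 := by
      have e2 : ((v + 6 * τ) * s') ^ 2 = (v + 6 * τ) ^ 2 * (b' * c') := by
        rw [show ((v + 6 * τ) * s') ^ 2 = (v + 6 * τ) ^ 2 * (s' * s') by ring, hss']
      rw [e1, e2]
      calc (v * b) * (v * c) ≤ ((v + 6 * τ) * (b - 3 * τ)) * ((v + 6 * τ) * (c - 3 * τ)) :=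
            mul_le_mul hA1 hA2 (mul_nonneg hv.le hc0.le) (mul_nonneg hv6 hb3)
        _ = (v + 6 * τ) ^ 2 * ((b - 3 * τ) * (c - 3 * τ)) := by ring
        _ ≤ (v + 6 * τ) ^ 2 * (b' * c') := by
            apply mul_le_mul_of_nonneg_left _ (by positivity)
            exact mul_le_mul (by linarith) (by linarith) hc3 hb'0.le
    have habs := sq_le_sq.mp hsq
    rw [abs_of_nonneg (mul_nonneg hv6 hs')] at habs
    exact (le_abs_self _).trans habs
  -- (B) `(v − 6τ) s' ≤ v s`
  have hB : (v - 6 * τ) * s' ≤ v * s := by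
    have hv6 : 0 ≤ v - 6 * τ := by linarith
    have hB1 : (v - 6 * τ) * (b + 3 * τ) ≤ v * b := by
      nlinarith [mul_nonneg hτ (by linarith : (0:ℝ) ≤ 2 * b - v + 6 * τ)]
    have hB2 : (v - 6 * τ) * (c + 3 * τ) ≤ v * c := by
      nlinarith [mul_nonneg hτ (by linarith : (0:ℝ) ≤ 2 * c - v + 6 * τ)]
    have hsq : ((v - 6 * τ) * s') ^ 2 ≤ (v * s) ^ 2 := by
      have e2 : ((v - 6 * τ) * s') ^ 2 = (v - 6 * τ) ^ 2 * (b' * c') := by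
        rw [show ((v - 6 * τ) * s') ^ 2 = (v - 6 * τ) ^ 2 * (s' * s') by ring, hss']
      rw [e1, e2]
      calc (v - 6 * τ) ^ 2 * (b' * c') ≤ (v - 6 * τ) ^ 2 * ((b + 3 * τ) * (c + 3 * τ)) := by
            apply mul_le_mul_of_nonneg_left _ (by positivity)
            exact mul_le_mul (by linarith) (by linarith) hc'0.le (by linarith)
        _ = ((v - 6 * τ) * (b + 3 * τ)) * ((v - 6 * τ) * (c + 3 * τ)) := by ring
        _ ≤ (v * b) * (v * c) :=
            mul_le_mul hB1 hB2 (mul_nonneg hv6 (by linarith)) (mul_nonneg hv.le hb0.le)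
    have habs := sq_le_sq.mp hsq
    rw [abs_of_nonneg (mul_nonneg hv.le hs)] at habs
    exact (le_abs_self _).trans habs
  -- hence `v |s − s'| ≤ 6 τ s'`
  have hdiff : v * |s - s'| ≤ 6 * τ * s' := by
    rw [← abs_of_pos hv, ← abs_mul]
    exact abs_le.mpr ⟨by linarith [hB], by linarith [hA]⟩
  -- combine
  have e : a' / s' - a / s = ((a' - a) * s + a * (s - s')) / (s' * s) := by
    field_simp
    ring
  have hnum : |(a' - a) * s + a * (s - s')| ≤ 3 * τ * s + s * |s - s'| := by
    calc |(a' - a) * s + a * (s - s')| ≤ |(a' - a) * s| + |a * (s - s')| := abs_add_le _ _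
      _ = |a' - a| * s + |a| * |s - s'| := by rw [abs_mul, abs_mul, abs_of_nonneg hs]
      _ ≤ 3 * τ * s + s * |s - s'| := by gcongr
  rw [e, abs_div, abs_of_pos (by positivity : (0:ℝ) < s' * s), div_le_div_iff₀ (by positivity) hv]
  calc |(a' - a) * s + a * (s - s')| * v ≤ (3 * τ * s + s * |s - s'|) * v := by gcongr
    _ = 3 * τ * s * v + s * (v * |s - s'|) := by ring
    _ ≤ 3 * τ * s * v + s * (6 * τ * s') := by gcongr
    _ ≤ 12 * τ * (s' * s) := by
        linarith [mul_nonneg (mul_nonneg hτ hs) (by linarith : (0:ℝ) ≤ 2 * s' - v)]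

/-- `[folklore]` Hoeffding + union-bound budget for `[−1,1]`-valued samples and `M` coordinates:
`n ≥ (2/ε²) log(2M/δ)` gives `2M·exp(−nε²/2) ≤ δ` (DEQ-A53 Theorem A53 (ii), (iii)). -/
theorem hoeffding_union_budget {M δ ε n : ℝ} (hM : 0 < M) (hδ : 0 < δ) (hε : 0 < ε)
    (hn : 2 * Real.log (2 * M / δ) / ε ^ 2 ≤ n) :
    2 * M * Real.exp (-(n * ε ^ 2 / 2)) ≤ δ := by
  have hlog : Real.log (2 * M / δ) ≤ n * ε ^ 2 / 2 := by
    rw [div_le_iff₀ (by positivity)] at hn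
    linarith
  have hexp : Real.exp (-(n * ε ^ 2 / 2)) ≤ (2 * M / δ)⁻¹ := by
    have := Real.exp_le_exp.mpr (show -(n * ε ^ 2 / 2) ≤ -Real.log (2 * M / δ) by linarith)
    rwa [Real.exp_neg (Real.log (2 * M / δ)), Real.exp_log (by positivity)] at this
  calc 2 * M * Real.exp (-(n * ε ^ 2 / 2)) ≤ 2 * M * (2 * M / δ)⁻¹ :=
        mul_le_mul_of_nonneg_left hexp (by positivity)
    _ = δ := by field_simp

/-- `[folklore]` Chernoff occupancy budget: `μ ≥ 8 log(M/δ)` gives `M·exp(−μ/8) ≤ δ`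
(every one of `M` cells of expected count `≥ μ` receives at least `μ/2` samples, DEQ-A53 (ii)). -/
theorem chernoff_occupancy_budget {M δ μ : ℝ} (hM : 0 < M) (hδ : 0 < δ)
    (hμ : 8 * Real.log (M / δ) ≤ μ) :
    M * Real.exp (-(μ / 8)) ≤ δ := by
  have hlog : Real.log (M / δ) ≤ μ / 8 := by linarith
  have hexp : Real.exp (-(μ / 8)) ≤ (M / δ)⁻¹ := by
    have := Real.exp_le_exp.mpr (show -(μ / 8) ≤ -Real.log (M / δ) by linarith)
    rwa [Real.exp_neg (Real.log (M / δ)), Real.exp_log (by positivity)] at this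
  calc M * Real.exp (-(μ / 8)) ≤ M * (M / δ)⁻¹ := mul_le_mul_of_nonneg_left hexp hM.le
    _ = δ := by field_simp

/-- `[folklore]` cell budget: if every cell has mass `p ≥ 1/q` under the sampling distribution and
`m ≥ q·n` samples are drawn, the expected cell count is `m·p ≥ n` (DEQ-A53 (ii): `q = k_C^{l+1}`). -/
theorem cell_budget {q p m n : ℝ} (hq : 0 < q) (hp : 1 / q ≤ p) (hn : 0 ≤ n) (hm : q * n ≤ m) :
    n ≤ m * p := by
  have h0 : 0 ≤ m := le_trans (by positivity) hm
  calc n = (q * n) * (1 / q) := by field_simp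
    _ ≤ m * p := mul_le_mul hm hp (by positivity) h0

end Literature.Computability.QuantumAlgorithms.SampledSupervisedSplit
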